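import Mathlib
import Summits.NavierStokesRegularity.NavierStokesRegularity.Theorems.PoloidalWindowDoorPoloidalWindowRigidityZShockTurningShearSaddle
import Summits.NavierStokesRegularity.NavierStokesRegularity.Theorems.PoloidalWindowDoorPoloidalWindowRigidityZShockTurningShearParabolic
import Summits.NavierStokesRegularity.NavierStokesRegularity.Theorems.PoloidalWindowDoorPoloidalWindowRigidityZShockTurningShearAligned

/-!
# Crux K2 `PoloidalWindowRigidity` (stmt-NavierStokesRegularity-19708), line `z_shock` — R3 inhabitant census: QUADRATIC SLICES
# WITH AN ARBITRARY STRUCTURE FUNCTION (IX, synthesis) — on a hyperbolic column whose structure function is STRICTLY genuinely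
# nonlinear, every quadratic-slice pattern of the autonomous height-evolution is horizontally constant

`--supports stmt-NavierStokesRegularity-19708 --as helper` (leafhand-ns-poloidalwindowdoor-3 g21, cell decomp-ns, 2026-09-01).  Class-free,
def-free; Mathlib + parts I–VIII of the turning-shear series (hand 3-g19: I `…ZShockTurningShear` p839511, II `…Quadratic` p839549;
this hand: III `…Definite` p840033, IV `…DefiniteHeights` p840052, V `…Indefinite` p840077, VI `…Saddle` p840125, VII `…Parabolic`
p840142, VIII `…Aligned`).  **No stub and no summit is closed by this file; Navier–Stokes regularity is NOT proved here (rung 0).**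

The single-height classification of parts III–VIII says: if a quadratic slice `W(y) = A + By₀ + Cy₁ + ½(Dy₀² + 2Ey₀y₁ + Gy₁²)` with
`Q = (D, E; E, G) ≠ 0` satisfies the height-evolution identity `ℓ = γ(W)(D+G) + γ'(W)|∇W|²` at ONE height for a differentiable `γ`,
then `γ'` is CONSTANT on a nontrivial interval (on all of `ℝ` when `Q` is indefinite or transverse rank one; on the value half-line
when `Q` is definite or aligned rank one).  This file assembles the cases:

* `reflect_data` — the symmetry `W ↦ −W`, `γ ↦ γ(−·)`, `ℓ ↦ −ℓ` of the single-height data (used for `D < 0` / `G < 0`).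
* ★ `exists_const_interval_of_Q_ne_zero` — **single height, any `Q ≠ 0`:** `∃ p < q, ∃ k, γ' = k on (p, q)`.
* ★ `quadSlice_Q_eq_zero_of_strictGN` — **all heights:** if `γ'` is constant on NO nontrivial interval (STRICT genuine nonlinearity of
  the column, e.g. `γ'' ≠ 0` on a dense set) then a quadratic-slice pattern solving the height-evolution at every height (data of part
  II) has `D ≡ E ≡ G ≡ 0`: it is a turning shear (affine slice) at every height.
* ★ `quadSlice_horizConst_of_strictGN` — adding hyperbolicity `γ ≥ 0` and `B, C ∈ C²` (data of part I): then also `B ≡ C ≡ 0` by part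
  I's `affineSlice_not_thick` — **on a strictly genuinely nonlinear hyperbolic column the quadratic family of R3 inhabitant candidates is
  EMPTY** (every member is horizontally constant, `W = A(s)` with `A'' = 0`).  No boundedness of the pattern is used anywhere.

Honest scope: a toy sub-family of R3 (`hGN` — the 2+1-D two-sided rigidity behind the deciding stub `stub_zShockThickAut` — stays XL and
not in print); kinematic (no NS); the substitution of the quadratic ansatz into the PDE is the displayed coefficient identity, taken as
hypothesis, as in parts I–VIII.  The non-strict thick column (`γ'` constant on some value interval, i.e. `G` locally cubic) keeps the
members described in parts II/IV.  presearch: as parts III–VIII (invariant-subspace / polynomial-ansatz literature treats polynomial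
nonlinearities only; nothing for a general structure function). [folklore]
-/

noncomputable section

namespace Summit.NavierStokesRegularity.NavierStokesRegularity.Theorems.PoloidalWindowDoorPoloidalWindowRigidityZShockTurningShearSynthesis

-- the summit and its single sub-problem share the name (CONVENTIONS §1)
set_option linter.dupNamespace false

open Set Filter Topology
open Summit.NavierStokesRegularity.NavierStokesRegularity.Theorems.PoloidalWindowDoorPoloidalWindowRigidityZShockTurningShear
open Summit.NavierStokesRegularity.NavierStokesRegularity.Theorems.PoloidalWindowDoorPoloidalWindowRigidityZShockTurningShearQuadratic
open Summit.NavierStokesRegularity.NavierStokesRegularity.Theorems.PoloidalWindowDoorPoloidalWindowRigidityZShockTurningShearDefinite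
open Summit.NavierStokesRegularity.NavierStokesRegularity.Theorems.PoloidalWindowDoorPoloidalWindowRigidityZShockTurningShearSaddle
open Summit.NavierStokesRegularity.NavierStokesRegularity.Theorems.PoloidalWindowDoorPoloidalWindowRigidityZShockTurningShearParabolic
open Summit.NavierStokesRegularity.NavierStokesRegularity.Theorems.PoloidalWindowDoorPoloidalWindowRigidityZShockTurningShearAligned

/-! ## The reflection of the single-height data -/

/-- **Reflection `W ↦ −W`, `γ ↦ γ(−·)`, `ℓ ↦ −ℓ`** preserves the single-height identity (with all coefficients negated and `P`
unchanged). [folklore] -/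
theorem reflect_data {γ γ' : ℝ → ℝ} (hγ : ∀ t, HasDerivAt γ (γ' t) t)
    {A B C D E G a b c d e g : ℝ} {W P ℓ : ℝ → ℝ → ℝ}
    (hW : ∀ y₀ y₁, W y₀ y₁ = A + B * y₀ + C * y₁ + (D * y₀ ^ 2 + 2 * E * y₀ * y₁ + G * y₁ ^ 2) / 2)
    (hP : ∀ y₀ y₁, P y₀ y₁ = (B + D * y₀ + E * y₁) ^ 2 + (C + E * y₀ + G * y₁) ^ 2)
    (hℓ : ∀ y₀ y₁, ℓ y₀ y₁ = a + b * y₀ + c * y₁ + (d * y₀ ^ 2 + 2 * e * y₀ * y₁ + g * y₁ ^ 2) / 2)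
    (hpde : ∀ y₀ y₁, ℓ y₀ y₁ = γ (W y₀ y₁) * (D + G) + γ' (W y₀ y₁) * P y₀ y₁) :
    (∀ t, HasDerivAt (fun t => γ (-t)) ((fun t => -γ' (-t)) t) t) ∧
    (∀ y₀ y₁, (fun y₀ y₁ => -W y₀ y₁) y₀ y₁ =
      -A + -B * y₀ + -C * y₁ + (-D * y₀ ^ 2 + 2 * -E * y₀ * y₁ + -G * y₁ ^ 2) / 2) ∧
    (∀ y₀ y₁, P y₀ y₁ = (-B + -D * y₀ + -E * y₁) ^ 2 + (-C + -E * y₀ + -G * y₁) ^ 2) ∧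
    (∀ y₀ y₁, (fun y₀ y₁ => -ℓ y₀ y₁) y₀ y₁ =
      -a + -b * y₀ + -c * y₁ + (-d * y₀ ^ 2 + 2 * -e * y₀ * y₁ + -g * y₁ ^ 2) / 2) ∧
    (∀ y₀ y₁, (fun y₀ y₁ => -ℓ y₀ y₁) y₀ y₁ =
      (fun t => γ (-t)) ((fun y₀ y₁ => -W y₀ y₁) y₀ y₁) * (-D + -G) +
        (fun t => -γ' (-t)) ((fun y₀ y₁ => -W y₀ y₁) y₀ y₁) * P y₀ y₁) := by
  refine ⟨fun t => ?_, fun y₀ y₁ => ?_, fun y₀ y₁ => ?_, fun y₀ y₁ => ?_, fun y₀ y₁ => ?_⟩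
  · have h := (hγ (-t)).comp t (hasDerivAt_neg t)
    simpa [Function.comp_def] using h
  · simp only [hW]; ring
  · rw [hP]; ring
  · simp only [hℓ]; ring
  · simp only [neg_neg, hpde]; ring

/-! ## Single height: every non-zero quadratic part pins `γ'` on an interval -/

/-- ★ **Single height, any `Q ≠ 0`.**  If `γ` is differentiable and a quadratic slice with `(D, E, G) ≠ 0` satisfies the
height-evolution identity at one height, then `γ'` is constant on some nontrivial open interval. [folklore] -/
theorem exists_const_interval_of_Q_ne_zero {γ γ' : ℝ → ℝ} (hγ : ∀ t, HasDerivAt γ (γ' t) t)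
    {A B C D E G a b c d e g : ℝ} {W P ℓ : ℝ → ℝ → ℝ}
    (hW : ∀ y₀ y₁, W y₀ y₁ = A + B * y₀ + C * y₁ + (D * y₀ ^ 2 + 2 * E * y₀ * y₁ + G * y₁ ^ 2) / 2)
    (hP : ∀ y₀ y₁, P y₀ y₁ = (B + D * y₀ + E * y₁) ^ 2 + (C + E * y₀ + G * y₁) ^ 2)
    (hℓ : ∀ y₀ y₁, ℓ y₀ y₁ = a + b * y₀ + c * y₁ + (d * y₀ ^ 2 + 2 * e * y₀ * y₁ + g * y₁ ^ 2) / 2)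
    (hQ : D ≠ 0 ∨ E ≠ 0 ∨ G ≠ 0)
    (hpde : ∀ y₀ y₁, ℓ y₀ y₁ = γ (W y₀ y₁) * (D + G) + γ' (W y₀ y₁) * P y₀ y₁) :
    ∃ p q k : ℝ, p < q ∧ ∀ t, p < t → t < q → γ' t = k := by
  -- packaging of the two conclusion shapes
  have ofGlobal : ∀ {μ : ℝ}, (∀ t, γ' t = 2 * μ) → ∃ p q k : ℝ, p < q ∧ ∀ t, p < t → t < q → γ' t = k :=
    fun {μ} h => ⟨0, 1, 2 * μ, one_pos, fun t _ _ => h t⟩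
  have ofRight : ∀ {m μ : ℝ}, (∀ τ, 0 < τ → γ' (m + τ) = 2 * μ) →
      ∃ p q k : ℝ, p < q ∧ ∀ t, p < t → t < q → γ' t = k := by
    intro m μ h
    refine ⟨m + 1, m + 2, 2 * μ, by linarith, fun t hp _ => ?_⟩
    have h1 := h (t - m) (by linarith)
    rwa [show m + (t - m) = t by ring] at h1
  have ofLeft : ∀ {m μ : ℝ}, (∀ τ, 0 < τ → (fun t => -γ' (-t)) (m + τ) = 2 * μ) →
      ∃ p q k : ℝ, p < q ∧ ∀ t, p < t → t < q → γ' t = k := by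
    intro m μ h
    refine ⟨-m - 2, -m - 1, -(2 * μ), by linarith, fun t _ hq => ?_⟩
    have h1 := h (-m - t) (by linarith)
    simp only at h1
    rw [show -(m + (-m - t)) = t by ring] at h1
    linarith
  obtain ⟨hγn, hWn, hPn, hℓn, hpden⟩ := reflect_data hγ hW hP hℓ hpde
  rcases lt_trichotomy (D * G - E ^ 2) 0 with hneg | hzero | hpos
  · -- indefinite, rank two (parts V–VI)
    obtain ⟨γ₀, μ, -, h⟩ := quadSlice_rank2Indef_affine hγ hW hP hℓ hneg hpde
    exact ofGlobal h
  · -- rank one (parts VII–VIII)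
    have hDG : D * G = E ^ 2 := by linarith
    by_cases hD : D = 0
    · -- then `E = 0`, `G ≠ 0`: swap the coordinates
      have hE : E = 0 := by
        have : E ^ 2 = 0 := by rw [← hDG, hD, zero_mul]
        exact pow_eq_zero_iff two_ne_zero |>.mp this
      have hG : G ≠ 0 := by
        rcases hQ with h | h | h
        · exact absurd hD h
        · exact absurd hE h
        · exact h
      by_cases hB : B * G - C * E = 0
      · -- aligned, swapped
        have hal : B * G = C * E := by linarith
        rcases lt_or_gt_of_ne hG with hGneg | hGpos
        · obtain ⟨m, γ₀, μ, -, -, -, h⟩ := quadSlice_rank1Aligned_affine hγn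
            (A := -A) (B := -C) (C := -B) (D := -G) (E := -E) (G := -D) (a := -a) (b := -c) (c := -b) (d := -g)
            (e := -e) (g := -d) (W := fun y₀ y₁ => -W y₁ y₀) (P := fun y₀ y₁ => P y₁ y₀) (ℓ := fun y₀ y₁ => -ℓ y₁ y₀)
            (fun y₀ y₁ => by rw [hW]; ring) (fun y₀ y₁ => by rw [hP]; ring) (fun y₀ y₁ => by rw [hℓ]; ring)
            (by linarith) (by linear_combination hDG) (by linear_combination hal)
            (fun y₀ y₁ => by have h := hpden y₁ y₀; simp only at h ⊢; rw [h]; ring)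
          exact ofLeft h
        · obtain ⟨m, γ₀, μ, -, -, -, h⟩ := quadSlice_rank1Aligned_affine hγ
            (A := A) (B := C) (C := B) (D := G) (E := E) (G := D) (a := a) (b := c) (c := b) (d := g) (e := e) (g := d)
            (W := fun y₀ y₁ => W y₁ y₀) (P := fun y₀ y₁ => P y₁ y₀) (ℓ := fun y₀ y₁ => ℓ y₁ y₀)
            (fun y₀ y₁ => by rw [hW]; ring) (fun y₀ y₁ => by rw [hP]; ring) (fun y₀ y₁ => by rw [hℓ]; ring)
            hGpos (by linear_combination hDG) (by linear_combination hal)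
            (fun y₀ y₁ => by rw [hpde, add_comm D G])
          exact ofRight h
      · obtain ⟨γ₀, μ, -, h⟩ := quadSlice_rank1_affine_swap hγ hW hP hℓ hG hDG hB hpde
        exact ofGlobal h
    · by_cases hβ : C * D - B * E = 0
      · -- aligned
        have hal : C * D = B * E := by linarith
        rcases lt_or_gt_of_ne hD with hDneg | hDpos
        · obtain ⟨m, γ₀, μ, -, -, -, h⟩ := quadSlice_rank1Aligned_affine hγn hWn hPn hℓn
            (by linarith) (by linear_combination hDG) (by linear_combination hal) hpden
          exact ofLeft h
        · obtain ⟨m, γ₀, μ, -, -, -, h⟩ := quadSlice_rank1Aligned_affine hγ hW hP hℓ hDpos hDG hal hpde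
          exact ofRight h
      · obtain ⟨γ₀, μ, -, h⟩ := quadSlice_rank1_affine hγ hW hP hℓ hD hDG hβ hpde
        exact ofGlobal h
  · -- definite (part III)
    have hD : D ≠ 0 := by
      intro h0; rw [h0, zero_mul] at hpos; nlinarith [sq_nonneg E]
    rcases lt_or_gt_of_ne hD with hDneg | hDpos
    · obtain ⟨m, γ₀, μ, -, -, -, h⟩ := quadSlice_posDef_affine hγn hWn hPn hℓn (by linarith)
        (by nlinarith) hpden
      exact ofLeft h
    · obtain ⟨m, γ₀, μ, -, -, -, h⟩ := quadSlice_posDef_affine hγ hW hP hℓ hDpos hpos hpde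
      exact ofRight h

/-! ## All heights: strict genuine nonlinearity empties the quadratic family -/

/-- ★ **Strict genuine nonlinearity ⇒ no quadratic part at any height.**  Data of part II at every height (`γ` differentiable; the
coefficient functions arbitrary).  If `γ'` is constant on NO nontrivial open interval, then a quadratic-slice pattern solving the
height-evolution at every height has `D ≡ E ≡ G ≡ 0` (it is an affine slice — a turning shear — at every height). [folklore] -/
theorem quadSlice_Q_eq_zero_of_strictGN {A B C D E G A'' B'' C'' D'' E'' G'' γ γ' : ℝ → ℝ}
    (hγ : ∀ t, HasDerivAt γ (γ' t) t)
    (hstrict : ∀ p q k : ℝ, p < q → ∃ t, p < t ∧ t < q ∧ γ' t ≠ k)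
    (hpde : ∀ z y₀ y₁ : ℝ,
      A'' z + B'' z * y₀ + C'' z * y₁ + (D'' z * y₀ ^ 2 + 2 * E'' z * y₀ * y₁ + G'' z * y₁ ^ 2) / 2 =
        γ (A z + B z * y₀ + C z * y₁ + (D z * y₀ ^ 2 + 2 * E z * y₀ * y₁ + G z * y₁ ^ 2) / 2) * (D z + G z) +
          γ' (A z + B z * y₀ + C z * y₁ + (D z * y₀ ^ 2 + 2 * E z * y₀ * y₁ + G z * y₁ ^ 2) / 2) *
            ((B z + D z * y₀ + E z * y₁) ^ 2 + (C z + E z * y₀ + G z * y₁) ^ 2)) :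
    ∀ z, D z = 0 ∧ E z = 0 ∧ G z = 0 := by
  intro z
  by_contra hne
  have hQ : D z ≠ 0 ∨ E z ≠ 0 ∨ G z ≠ 0 := by
    by_contra h
    rw [not_or, not_or, not_ne_iff, not_ne_iff, not_ne_iff] at h
    exact hne h
  obtain ⟨p, q, k, hpq, hk⟩ := exists_const_interval_of_Q_ne_zero hγ
    (W := fun y₀ y₁ => A z + B z * y₀ + C z * y₁ + (D z * y₀ ^ 2 + 2 * E z * y₀ * y₁ + G z * y₁ ^ 2) / 2)
    (P := fun y₀ y₁ => (B z + D z * y₀ + E z * y₁) ^ 2 + (C z + E z * y₀ + G z * y₁) ^ 2)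
    (ℓ := fun y₀ y₁ => A'' z + B'' z * y₀ + C'' z * y₁ + (D'' z * y₀ ^ 2 + 2 * E'' z * y₀ * y₁ + G'' z * y₁ ^ 2) / 2)
    (fun _ _ => rfl) (fun _ _ => rfl) (fun _ _ => rfl) hQ (fun y₀ y₁ => hpde z y₀ y₁)
  obtain ⟨t, hpt, htq, hγt⟩ := hstrict p q k hpq
  exact hγt (hk t hpt htq)

/-- ★ **On a strictly genuinely nonlinear hyperbolic column the quadratic family is horizontally trivial.**  Data of parts I–II at
every height (`B, C, D, E, G ∈ C²` with pointwise first and second derivatives; `γ` differentiable, `γ ≥ 0` = hyperbolicity on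
`ℝ`, `γ'` constant on no interval).  Then a quadratic-slice pattern solving the height-evolution at every height is horizontally constant:
`B ≡ C ≡ D ≡ E ≡ G ≡ 0` (and `A'' ≡ 0`).  Parts III–VIII kill the quadratic part, part I (`affineSlice_not_thick`) the linear part.
[folklore] -/
theorem quadSlice_horizConst_of_strictGN {A B C D E G B' C' D' E' G' A'' B'' C'' D'' E'' G'' γ γ' : ℝ → ℝ}
    (hB : ∀ z, HasDerivAt B (B' z) z) (hB' : ∀ z, HasDerivAt B' (B'' z) z)
    (hC : ∀ z, HasDerivAt C (C' z) z) (hC' : ∀ z, HasDerivAt C' (C'' z) z)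
    (hD : ∀ z, HasDerivAt D (D' z) z) (hD' : ∀ z, HasDerivAt D' (D'' z) z)
    (hE : ∀ z, HasDerivAt E (E' z) z) (hE' : ∀ z, HasDerivAt E' (E'' z) z)
    (hG : ∀ z, HasDerivAt G (G' z) z) (hG' : ∀ z, HasDerivAt G' (G'' z) z)
    (hγ : ∀ t, HasDerivAt γ (γ' t) t) (hhyp : ∀ t, 0 ≤ γ t)
    (hstrict : ∀ p q k : ℝ, p < q → ∃ t, p < t ∧ t < q ∧ γ' t ≠ k)
    (hpde : ∀ z y₀ y₁ : ℝ,
      A'' z + B'' z * y₀ + C'' z * y₁ + (D'' z * y₀ ^ 2 + 2 * E'' z * y₀ * y₁ + G'' z * y₁ ^ 2) / 2 =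
        γ (A z + B z * y₀ + C z * y₁ + (D z * y₀ ^ 2 + 2 * E z * y₀ * y₁ + G z * y₁ ^ 2) / 2) * (D z + G z) +
          γ' (A z + B z * y₀ + C z * y₁ + (D z * y₀ ^ 2 + 2 * E z * y₀ * y₁ + G z * y₁ ^ 2) / 2) *
            ((B z + D z * y₀ + E z * y₁) ^ 2 + (C z + E z * y₀ + G z * y₁) ^ 2)) :
    ∀ z, B z = 0 ∧ C z = 0 ∧ D z = 0 ∧ E z = 0 ∧ G z = 0 := by
  have hQ := quadSlice_Q_eq_zero_of_strictGN hγ hstrict hpde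
  -- second derivatives of the identically vanishing coefficients vanish
  have second_zero : ∀ {F F' F'' : ℝ → ℝ}, (∀ z, HasDerivAt F (F' z) z) → (∀ z, HasDerivAt F' (F'' z) z) →
      (∀ z, F z = 0) → ∀ z, F'' z = 0 := by
    intro F F' F'' hF hF' h0 z
    have hF0 : F = fun _ => 0 := funext h0
    have h1 : ∀ w, F' w = 0 := fun w => (hF w).unique (by rw [hF0]; exact hasDerivAt_const w 0)
    have hF'0 : F' = fun _ => 0 := funext h1
    exact (hF' z).unique (by rw [hF'0]; exact hasDerivAt_const z 0)
  have hD'' : ∀ z, D'' z = 0 := second_zero hD hD' (fun z => (hQ z).1)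
  have hE'' : ∀ z, E'' z = 0 := second_zero hE hE' (fun z => (hQ z).2.1)
  have hG'' : ∀ z, G'' z = 0 := second_zero hG hG' (fun z => (hQ z).2.2)
  -- the pattern is an affine slice at every height: part I's identity
  have hpdeI : ∀ z x₀ x₁ : ℝ, A'' z + B'' z * x₀ + C'' z * x₁ = γ' (A z + B z * x₀ + C z * x₁) * (B z ^ 2 + C z ^ 2) := by
    intro z x₀ x₁
    obtain ⟨hD0, hE0, hG0⟩ := hQ z
    have h := hpde z x₀ x₁
    rw [hD'' z, hE'' z, hG'' z, hD0, hE0, hG0] at h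
    simp only [zero_mul, mul_zero, add_zero, zero_add, zero_div] at h
    linear_combination h
  intro z
  obtain ⟨hD0, hE0, hG0⟩ := hQ z
  by_cases hnd : ∃ z₀, B z₀ ≠ 0 ∨ C z₀ ≠ 0
  · -- part I: a non-degenerate turning shear forces `γ' ≡ 0`, contradicting strictness
    have h0 := affineSlice_not_thick hB hB' hC hC' hγ hhyp hpdeI hnd
    obtain ⟨t, -, -, hγt⟩ := hstrict 0 1 0 one_pos
    exact absurd (h0 t) hγt
  · rw [not_exists] at hnd
    have h := hnd z
    rw [not_or, not_ne_iff, not_ne_iff] at h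
    exact ⟨h.1, h.2, hD0, hE0, hG0⟩

end Summit.NavierStokesRegularity.NavierStokesRegularity.Theorems.PoloidalWindowDoorPoloidalWindowRigidityZShockTurningShearSynthesis

end
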